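import Summits.HodgeConjecture.HodgeConjecture.Theorems.F0P3SpectralPacketTrace       -- ★ (N) FILE 3d p842372: `SpectralPacketG.tr` (+ ★ 3a `SpectralPacketG`, `trS`; ★ 2b `evpAt`, `ramFinset`; ★ 2c; ★ `TestS₀`; `TestG`, `splitForm`)
import Literature.NumberTheory.Automorphic.IrreducibleClassesComapSpherical           -- ★ `IrrClass.comap` (+ `comap_comap_symm`, `IsAdmissible.comap`, `isSpherical_comap_iff_of_forall_mem_iff`)
import HarnessLib

/-!
# (N) DEFS, FILE 3f — ψ-TRANSPORT OF THE TUPLE'S `G′`-READINGS: `evpGψ` (the e.v.p. slot `evpG : PG → EvpData L H`), `trSψ` (the semilocal trace slot `trGS` on `G′`-data),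
# `transportAPackets` (the SCD record's A-packets as packets of `G_v`-classes) — Rogawski §14.2 p. 232 (i)–(iii) «we fix an inner isomorphism `ψ : G′ → G` …
# `G′_v ≅ G_v` for all finite `v`», §14.6 p. 243 «`Tr Π_S(f_S) = Tr Π_S(f′_S)`», §13.7 p. 206

Cell `hodgecm-mathlib` (D-0151), F0∕P3 «U3-mult», crux H413 (`stmt-HodgeConjecture-24833`), route of record `HCCMUnconditional`.  (N) lead pen F0P3a-p01 (g12); census
`F0/P3a/F0P3a-p01/g12/CENSUS-N-FILE3-WIRING.F0P3a-p01g12.md` 9c106a7a (FILE 3 v1 wiring) §W0 (THE FRAME FACT) + §W2 FILE 3f; LEAD F0P3a-plan (g10).  Definition lane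
(three data `def`s with explicit binders) + `rfl`∕`if` read-backs; namespace of ★ FILE 3a (`…F0P3SpectralPacket.SpectralPacketG`) and `…F0P3SpectralPacket`; box-before-file
(B-typ03); `--supports stmt-HodgeConjecture-24833 --as helper`.  No instance, no notation, no named fact, no `sorry`; the local identifications `ψ v` are a PARAMETER
(instantiated by the pinned kit's `ComparisonKit.ψ`), the `G`-frame measures `νG v` are a parameter (the tuple passes the letter's Haar measures on `G′_v` transported by `ψ v`).
HONEST LABEL: HC_CM is proved only modulo the printed citations until rung 0 closes; this file proves no printed statement — it DEFINES how the quasi-split-frame packet data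
(★ FILE 1 kit at `H′ = splitForm L 3`, forced by `IsDiscrete μG` and `trG` on `TestG L`, census §W0) are READ at the inner form `G′ = U(H)` where the letter `K9SpectralLetter` types
`evpG`, the (P4) anchors, `trGS` and the ξ-side record.

THE FRAME FACT (census §W0).  `PG := SpectralPacketG 𝔩 𝔞 μG` with `μG` the automorphic measure of `G = U(Φ₃)` and `trG` on `C_c(G(𝔸))` puts the kit at the quasi-split frame; print
identifies `G′_v = G_v` at every finite `v` by `ψ_v` [§14.2 p. 232], and reads `Tr Π_v(f′_v) := Tr (Π_v ∘ ψ_v)(f′_v)`, `t(Π)_v` on `𝓗(G′_v, K′_v)` through `ψ_v`, and the A-packets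
`Π(ξ_v)` as packets of either group [§14.6 p. 243; §13.7 p. 206].  The three definitions below are exactly these readings.

CONTENTS.
* §1 (f1) **`SpectralPacketG.evpGψ Q ψ νG : ∀ v, ((cmDatum L 3 H).Local v → ℂ) → ℂ`** (= `EvpData L H`) — `t(Π)` READ ON `G′_v`: on a test function `f′` (compact support,
  level `K′_v = U(H)(𝒪_v)`) the value `Π.evpAt v (νG v) (f′ ∘ ψ_v⁻¹)` (★ FILE 2b), and `0` otherwise — the letter's (P5) convention at the `G′`-frame holds BY DEFINITION at EVERY
  `v` (`evpGψ_of_not`), including the finitely many where `ψ_v(K′_v) ≠ K_v`; `evpGψ_of_test`, `evpGψ_of_not_unr`, `evpGψ_of_unr`.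
* §2 (f2) **`SpectralPacketG.trSψ Q ψ S νG archTr′ fS`** — THE SLOT `trGS S Q f′_S = Tr Π_∞(f′_∞) · ∏_{v∈S} Tr (Π_v ∘ ψ_v)(f′_v)` on the `G′`-semilocal datum ★ `TestS₀ L H ι T hT S`
  (★ FILE 1b `trPktInf` at the compact-side distribution characters `archTr′` — the closer's ★ `archTr₀` — times ★ FILE 1 `trPkt` at `fS.loc v ∘ ψ_v⁻¹`); = ★ FILE 3a `trS` read
  through `ψ` (`trS` is the `ψ = id` case at the kit's own frame); `trSψ_eq`.
* §3 (f3) **`transportAPackets ψ Pk′ ξ v := (Pk′ ξ v).map (IrrClass.comap (ψ v).symm)`** — a record of A-packets of `G′_v`-classes (consumers: ★ `xiPacketFamilyOfRecordSCD …`)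
  as A-packets of `G_v`-classes, the `Pk` argument of ★ FILE 3e `XiPacketsDiscrete` ∕ ★ FILE 3c `IsPacketOf` (★ `LocalAPacket.map`, ★ `IrrClass.comap`);
  `transportAPackets_πn`, `transportAPackets_πs`, `comap_transportAPackets_πn` (round trip).

References: [Rogawski1990] §14.2 p. 232 (i)–(iii), §14.6 p. 243, §13.7 p. 206, §13.1 p. 199; [CartierCorvallis1979] §IV.1 (Satake ∕ e.v.p. on `𝓗(G_v, K_v)`).
-/

set_option autoImplicit false
-- the mandated namespace repeats `HodgeConjecture.HodgeConjecture`, as in every `Theorems/*.lean` of this sub-problem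
set_option linter.dupNamespace false

noncomputable section

open NumberField IsDedekindDomain MeasureTheory
open scoped Matrix MatrixGroups

open Literature.NumberTheory Literature.NumberTheory.Automorphic Literature.NumberTheory.Automorphic.UnitaryGroup
open Literature.NumberTheory.Rogawski1990 Literature.NumberTheory.GaloisRepresentations
open Literature.RepresentationTheory.BorelWallach2000 Literature.RepresentationTheory.KonnoKonno2007
open Summit.HodgeConjecture.HodgeConjecture.Cruxes.H413.F0P3InnerFormClassificationV6 (TestG splitForm)
open Summit.HodgeConjecture.HodgeConjecture.Cruxes.H413.F0P3LocalPacketKit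
open Summit.HodgeConjecture.HodgeConjecture.Cruxes.H413.F0P3ArchPacketKit
open Summit.HodgeConjecture.HodgeConjecture.Cruxes.H413.F0P3SemilocalTestFunctionsOfRecord (TestS₀)

namespace Summit.HodgeConjecture.HodgeConjecture.Cruxes.H413.F0P3SpectralPacket

variable {L : Type} [Field L] [NumberField L] [IsCMField L] {H : Matrix (Fin 3) (Fin 3) L}

/-! ## §3 (f3) The ξ-side record read on `G_v` [§13.1 p. 199; §14.2 p. 232] (stated first: kit-free) -/

/-- **(f3) `transportAPackets ψ Pk′` — A-PACKETS OF `G′_v`-CLASSES AS A-PACKETS OF `G_v`-CLASSES** along the local identifications `ψ_v : G′_v ≃ G_v`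
(`IrrClass.comap ψ_v⁻¹`: a representation of `G′_v` composed with `ψ_v⁻¹ : G_v → G′_v`).  Consumers: `Pk′ := xiPacketFamilyOfRecordSCD …` (the SCD record at the inner form),
giving the `Pk` of ★ FILE 3e `XiPacketsDiscrete` ∕ ★ FILE 3c `IsPacketOf`. [cite: Rogawski1990, §13.1 p. 199; §14.2 p. 232] -/
def transportAPackets (ψ : ∀ v : HeightOneSpectrum (𝓞 ↥(maximalRealSubfield L)), (cmDatum L 3 H).Local v ≃ₜ* (cmDatum L 3 (splitForm L 3)).Local v)
    (Pk' : OneDimAutRepH L → ∀ v : HeightOneSpectrum (𝓞 ↥(maximalRealSubfield L)), CMLocalAPacket L H v)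
    (ξ : OneDimAutRepH L) (v : HeightOneSpectrum (𝓞 ↥(maximalRealSubfield L))) : CMLocalAPacket L (splitForm L 3) v :=
  (Pk' ξ v).map (IrrClass.comap (ψ v).symm)

variable (ψ : ∀ v : HeightOneSpectrum (𝓞 ↥(maximalRealSubfield L)), (cmDatum L 3 H).Local v ≃ₜ* (cmDatum L 3 (splitForm L 3)).Local v)
  (Pk' : OneDimAutRepH L → ∀ v : HeightOneSpectrum (𝓞 ↥(maximalRealSubfield L)), CMLocalAPacket L H v)
  (ξ : OneDimAutRepH L) (v : HeightOneSpectrum (𝓞 ↥(maximalRealSubfield L)))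

/-- `πⁿ` of the transported packet. [cite: Rogawski1990, §13.1 p. 199] -/
theorem transportAPackets_πn : (transportAPackets ψ Pk' ξ v).πn = IrrClass.comap (ψ v).symm (Pk' ξ v).πn :=
  rfl

/-- `πˢ` of the transported packet. [cite: Rogawski1990, §13.1 p. 199] -/
theorem transportAPackets_πs : (transportAPackets ψ Pk' ξ v).πs = (Pk' ξ v).πs.map (IrrClass.comap (ψ v).symm) :=
  rfl

/-- Round trip: reading the transported `πⁿ` back on `G′_v` gives the record's `πⁿ` (★ `IrrClass.comap_comap_symm`). [cite: Rogawski1990, §14.2 p. 232] -/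
theorem comap_transportAPackets_πn : IrrClass.comap (ψ v) (transportAPackets ψ Pk' ξ v).πn = (Pk' ξ v).πn := by
  rw [transportAPackets_πn, IrrClass.comap_comap_symm]

/-- The members of the transported packet are the images of the record's members. [cite: Rogawski1990, §13.1 p. 199] -/
theorem members_transportAPackets : (transportAPackets ψ Pk' ξ v).members = IrrClass.comap (ψ v).symm '' (Pk' ξ v).members :=
  LocalAPacket.members_map _ _

namespace SpectralPacketG

variable {𝔩 : ∀ v : HeightOneSpectrum (𝓞 ↥(maximalRealSubfield L)), LocalPacketKit L (splitForm L 3) v} {𝔞 : ArchPacketKit}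
  {μ : Measure (adelicGroupData (↥(maximalRealSubfield L)) L (IsCMField.complexConj L) 3 (splitForm L 3)).automorphicQuotient}
  [SMulInvariantMeasure (adelicGroupData (↥(maximalRealSubfield L)) L (IsCMField.complexConj L) 3 (splitForm L 3)).Adelic
    (adelicGroupData (↥(maximalRealSubfield L)) L (IsCMField.complexConj L) 3 (splitForm L 3)).automorphicQuotient μ]

/-! ## §1 (f1) The e.v.p. slot read on `G′_v` [§13.7 p. 206; §14.2 p. 232] -/

/-- **(f1) `Q.evpGψ ψ νG : EvpData L H` — THE e.v.p. `t(Π)` READ ON THE INNER FORM**: at `v`, on a test function `f′ : G′_v → ℂ` (compact support and level `K′_v = U(H)(𝒪_v)`)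
the value `Π.evpAt v (νG v) (f′ ∘ ψ_v⁻¹)` of ★ FILE 2b's e.v.p. (the normalised eigencharacter of the unramified member, junk `0` at ramified `v`), and `0` on every other `f′` —
the letter's (P5) convention at the `G′`-frame, by definition at EVERY `v` [§13.7 p. 206 «`t(Π)_v ∈ Hom(𝓗_v, ℂ)`»; §14.2 p. 232 «identify `G′_v` and `G_v`»].
[cite: Rogawski1990, §13.7 p. 206; §14.2 p. 232] [cite: CartierCorvallis1979, §IV.1] -/
def evpGψ (Q : SpectralPacketG 𝔩 𝔞 μ)
    (ψ : ∀ v : HeightOneSpectrum (𝓞 ↥(maximalRealSubfield L)), (cmDatum L 3 H).Local v ≃ₜ* (cmDatum L 3 (splitForm L 3)).Local v)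
    [∀ v : HeightOneSpectrum (𝓞 ↥(maximalRealSubfield L)), MeasurableSpace ((cmDatum L 3 (splitForm L 3)).Local v)]
    (νG : ∀ v : HeightOneSpectrum (𝓞 ↥(maximalRealSubfield L)), Measure ((cmDatum L 3 (splitForm L 3)).Local v))
    (v : HeightOneSpectrum (𝓞 ↥(maximalRealSubfield L))) (f : (cmDatum L 3 H).Local v → ℂ) : ℂ :=
  open scoped Classical in
  if HasCompactSupport f ∧ IsLevel (cmLocalIntegralLevel L 3 H v) f then Q.fin.evpAt v (νG v) (f ∘ (ψ v).symm) else 0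

variable {Q : SpectralPacketG 𝔩 𝔞 μ}
  {ψ : ∀ v : HeightOneSpectrum (𝓞 ↥(maximalRealSubfield L)), (cmDatum L 3 H).Local v ≃ₜ* (cmDatum L 3 (splitForm L 3)).Local v}
  [∀ v : HeightOneSpectrum (𝓞 ↥(maximalRealSubfield L)), MeasurableSpace ((cmDatum L 3 (splitForm L 3)).Local v)]
  {νG : ∀ v : HeightOneSpectrum (𝓞 ↥(maximalRealSubfield L)), Measure ((cmDatum L 3 (splitForm L 3)).Local v)}
  {v : HeightOneSpectrum (𝓞 ↥(maximalRealSubfield L))}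

/-- **(P5) at the `G′`-frame, by definition**: off the test functions of level `K′_v`, `evpGψ … f′ = 0`. [cite: Rogawski1990, §13.7 p. 206] [cite: CartierCorvallis1979, §IV.1] -/
theorem evpGψ_of_not {f : (cmDatum L 3 H).Local v → ℂ} (hf : ¬ (HasCompactSupport f ∧ IsLevel (cmLocalIntegralLevel L 3 H v) f)) :
    Q.evpGψ ψ νG v f = 0 := by
  rw [evpGψ, if_neg hf]

/-- On the test functions of level `K′_v`: the `G`-frame e.v.p. at `f′ ∘ ψ_v⁻¹`. [cite: Rogawski1990, §13.7 p. 206; §14.2 p. 232] -/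
theorem evpGψ_of_test {f : (cmDatum L 3 H).Local v → ℂ} (hf : HasCompactSupport f ∧ IsLevel (cmLocalIntegralLevel L 3 H v) f) :
    Q.evpGψ ψ νG v f = Q.fin.evpAt v (νG v) (f ∘ (ψ v).symm) := by
  rw [evpGψ, if_pos hf]

/-- At a RAMIFIED place of `Π` the slot is `0` (★ FILE 2b `evpAt_of_not_unr`). [cite: Rogawski1990, §13.7 p. 206] -/
theorem evpGψ_of_not_unr (h : ¬ (𝔩 v).unr (Q.fin.loc v)) : Q.evpGψ ψ νG v = 0 := by
  funext f
  by_cases hf : HasCompactSupport f ∧ IsLevel (cmLocalIntegralLevel L 3 H v) f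
  · rw [evpGψ_of_test hf, Q.fin.evpAt_of_not_unr v (νG v) h, Pi.zero_apply, Pi.zero_apply]
  · rw [evpGψ_of_not hf, Pi.zero_apply]

/-- At an UNRAMIFIED place, on test functions: the kit's `evpPkt` (normalised eigencharacter of the unramified member) at `f′ ∘ ψ_v⁻¹`. [cite: Rogawski1990, §13.7 p. 206] [cite: CartierCorvallis1979, §IV.1] -/
theorem evpGψ_of_unr (h : (𝔩 v).unr (Q.fin.loc v)) {f : (cmDatum L 3 H).Local v → ℂ}
    (hf : HasCompactSupport f ∧ IsLevel (cmLocalIntegralLevel L 3 H v) f) :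
    Q.evpGψ ψ νG v f = (𝔩 v).evpPkt (νG v) (Q.fin.loc v) h (f ∘ (ψ v).symm) := by
  rw [evpGψ_of_test hf, Q.fin.evpAt_of_unr v (νG v) h]

/-! ## §2 (f2) The semilocal trace slot on `G′`-data [§14.6 p. 243; §14.2 p. 233] -/

/-- **(f2) `Q.trSψ ψ S νG archTr′ fS` — THE SLOT `trGS S Q f′_S := Tr Π_∞(f′_∞) · ∏_{v ∈ S} Tr (Π_v ∘ ψ_v)(f′_v)`** on the `G′`-semilocal test datum ★ `TestS₀ L H ι T hT S`:
★ FILE 1b `trPktInf` at the compact-side distribution characters `archTr′` (the closer's ★ `archTr₀ …`, `GpInf → ℂ` test functions) times ★ FILE 1 `trPkt` at the transported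
factors `fS.loc v ∘ ψ_v⁻¹` and the `G`-frame measures `νG v` [§14.6 p. 243 «`Tr Π_S(f_S) = Tr Π_S(f′_S)`»; §14.2 p. 233].  ★ FILE 3a `trS` is the `ψ = id` reading at the kit's own frame.
[cite: Rogawski1990, §14.6 p. 243; §14.2 p. 233; §13.3 p. 203] -/
def trSψ (Q : SpectralPacketG 𝔩 𝔞 μ)
    (ψ : ∀ v : HeightOneSpectrum (𝓞 ↥(maximalRealSubfield L)), (cmDatum L 3 H).Local v ≃ₜ* (cmDatum L 3 (splitForm L 3)).Local v)
    {ι : L →+* ℂ} {T : GL (Fin 3) ℂ} {hT : (T : Matrix (Fin 3) (Fin 3) ℂ)ᴴ * H.map ι * (T : Matrix (Fin 3) (Fin 3) ℂ) = Literature.Geometry.ComplexHyperbolic.BallModel.J}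
    (S : Finset (HeightOneSpectrum (𝓞 ↥(maximalRealSubfield L))))
    (νG : ∀ v : HeightOneSpectrum (𝓞 ↥(maximalRealSubfield L)), Measure ((cmDatum L 3 (splitForm L 3)).Local v))
    (archTr' : GKIrrClass (uFormGroup (Fin 2) (Fin 1)) → (UnitaryGroup.arch (↥(maximalRealSubfield L)) L (IsCMField.complexConj L) 3 H → ℂ) → ℂ)
    (fS : TestS₀ L H ι T hT S) : ℂ :=
  𝔞.trPktInf archTr' Q.inf fS.arch * ∏ v : ↥S, (𝔩 v.1).trPkt (νG v.1) (Q.fin.loc v.1) (fS.loc v ∘ (ψ v.1).symm)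

/-- Unfolding of (f2). [cite: Rogawski1990, §14.6 p. 243; §13.3 p. 203] -/
theorem trSψ_eq (Q : SpectralPacketG 𝔩 𝔞 μ)
    (ψ : ∀ v : HeightOneSpectrum (𝓞 ↥(maximalRealSubfield L)), (cmDatum L 3 H).Local v ≃ₜ* (cmDatum L 3 (splitForm L 3)).Local v)
    {ι : L →+* ℂ} {T : GL (Fin 3) ℂ} {hT : (T : Matrix (Fin 3) (Fin 3) ℂ)ᴴ * H.map ι * (T : Matrix (Fin 3) (Fin 3) ℂ) = Literature.Geometry.ComplexHyperbolic.BallModel.J}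
    (S : Finset (HeightOneSpectrum (𝓞 ↥(maximalRealSubfield L))))
    (νG : ∀ v : HeightOneSpectrum (𝓞 ↥(maximalRealSubfield L)), Measure ((cmDatum L 3 (splitForm L 3)).Local v))
    (archTr' : GKIrrClass (uFormGroup (Fin 2) (Fin 1)) → (UnitaryGroup.arch (↥(maximalRealSubfield L)) L (IsCMField.complexConj L) 3 H → ℂ) → ℂ)
    (fS : TestS₀ L H ι T hT S) :
    Q.trSψ ψ S νG archTr' fS = 𝔞.trPktInf archTr' Q.inf fS.arch * ∏ v : ↥S, (𝔩 v.1).trPkt (νG v.1) (Q.fin.loc v.1) (fS.loc v ∘ (ψ v.1).symm) :=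
  rfl

/-- The archimedean factor is the one ★ FILE 3a's `trS` uses (same kit `𝔞`, same `Q.inf`): only the finite factors are transported. [cite: Rogawski1990, §14.2 p. 233] -/
theorem trSψ_eq_trPktInf_mul (Q : SpectralPacketG 𝔩 𝔞 μ)
    (ψ : ∀ v : HeightOneSpectrum (𝓞 ↥(maximalRealSubfield L)), (cmDatum L 3 H).Local v ≃ₜ* (cmDatum L 3 (splitForm L 3)).Local v)
    {ι : L →+* ℂ} {T : GL (Fin 3) ℂ} {hT : (T : Matrix (Fin 3) (Fin 3) ℂ)ᴴ * H.map ι * (T : Matrix (Fin 3) (Fin 3) ℂ) = Literature.Geometry.ComplexHyperbolic.BallModel.J}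
    (νG : ∀ v : HeightOneSpectrum (𝓞 ↥(maximalRealSubfield L)), Measure ((cmDatum L 3 (splitForm L 3)).Local v))
    (archTr' : GKIrrClass (uFormGroup (Fin 2) (Fin 1)) → (UnitaryGroup.arch (↥(maximalRealSubfield L)) L (IsCMField.complexConj L) 3 H → ℂ) → ℂ)
    (fS : TestS₀ L H ι T hT (∅ : Finset (HeightOneSpectrum (𝓞 ↥(maximalRealSubfield L))))) :
    Q.trSψ ψ ∅ νG archTr' fS = 𝔞.trPktInf archTr' Q.inf fS.arch := by
  rw [trSψ_eq, Finset.univ_eq_empty, Finset.prod_empty, mul_one]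

end SpectralPacketG

end Summit.HodgeConjecture.HodgeConjecture.Cruxes.H413.F0P3SpectralPacket

end
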